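import Summits.QuantumFields.YangMills.Theorems.LuscherReductionTwistedTraceScalingBOCentralTube
import HarnessLib

/-!
# (C1-α) THE (C1) GLUE WITH A DECOUPLED INNER RADIUS: Gaussian constants at the inner radius `R_in`, support radius `R` only in the transport exponents
# (lane A of S-BASE, crux `TwistedTraceScaling` stmt-QuantumFields-20203, C4-CORE, the (OD) pen; `pub/ym-fleet/ym-luscher-20007-p1/COARSE-DESIGN.md` §28.6)

★★★ `central_transfer_two_sided_of_localisedAvg_inner` — `…BOCentralTube.central_transfer_two_sided_of_localisedAvg_local` verbatim, except that the fibre point lies in the INNER core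
`‖linkEmbed v'‖ ≤ R_in ≤ R`: the central Gaussian (`central_gaussian_tube_lower_local/upper`) is evaluated with `R_in` (factors `e^{±882βT²R_in²}`, `e^{49βR_in²}`, locality `6T²R_in`),
the bricks glue (`central_transfer_two_sided_of_bricks`) with the support radius `R`.  With `R = r_f = β^{-1/2}ℓ` and `R_in = r_f/12`, `R₀ ≈ 0.83r_f` the lower constant is informative
(cdisprove R46 (1), COARSE-DESIGN §28.6); the (C1c') suppliers `…BOLocalisedAvgChartUpper/Lower` provide hAhi/hAlo.
HONEST FRAMING: glue bookkeeping for a stub of a child of the CONDITIONAL route R2b1; (C1) packaging/rates, (C4), (C5), (B-ST) OPEN; C4-CORE OPEN; not infinite volume, not a gap, not Clay.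
-/

set_option autoImplicit false

noncomputable section

open MeasureTheory Filter Topology Real
open scoped BigOperators RealInnerProductSpace
open Literature.MathematicalPhysics.QuantumFieldTheory
open Literature.MathematicalPhysics.QuantumLattice

namespace Summit.QuantumFields.YangMills.Theorems.FemtoTransferGap.TwoLattice.ConstTube

open Summit.QuantumFields.YangMills.Theorems.FemtoTransferGap
open Summit.QuantumFields.YangMills.Theorems.FemtoTransferGap.TwoLattice
open Summit.QuantumFields.YangMills.Theorems.FemtoTransferGap.TwoLattice.Avg
open Summit.QuantumFields.YangMills.Theorems.FemtoTransferGap.TwoLattice.Stiff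
open Summit.QuantumFields.YangMills.Theorems.FemtoTransferGap.TwoLattice.GnChart

variable {L : ℕ} [NeZero L]

/-- ★★★ **(C1) FROM (C1c') ALONE, RELATIVE-LOCAL FORM WITH A DECOUPLED INNER RADIUS**: as `…BOCentralTube.central_transfer_two_sided_of_localisedAvg_local`, but the fibre point is in the
INNER core `‖linkEmbed v'‖ ≤ R_in ≤ R` and the Gaussian constants (`882βT²R_in²`, `49βR_in²`, `6T²R_in`) use `R_in`, while the support radius `R` of the profile enters only the transport
exponents `coreEta/coreEps` (answers cdisprove R46 (1): the vacuity radius is governed by `R_in`, not by the support radius). [cite: Luscher1983, §3] -/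
theorem central_transfer_two_sided_of_localisedAvg_inner {β : ℝ} (hβ : 0 < β) {Ω : LinkSpace L → ℝ} (hΩm : Measurable Ω) {CΩ : ℝ} (hCΩ : ∀ x, |Ω x| ≤ CΩ) (hΩ0 : ∀ x, 0 ≤ Ω x)
    {W : (Site 3 L → SU2) → ℝ} (hW : Measurable W) {CW : ℝ} (hCW : ∀ g, |W g| ≤ CW) (hW0 : ∀ g, 0 ≤ W g)
    {δu T R Γ σ : ℝ} (hδu1 : δu ≤ 1) (hT0 : 0 ≤ T) (hT : T ≤ 1 / 30) (hσ0 : 0 ≤ σ) (hσ : σ < 2)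
    (hΩt : ∀ v : Edge 3 L → Fin 3 → ℝ, Ω (linkEmbed L v) ≠ 0 → v ∈ capBalancedSet L ∧ (∀ (e : Edge 3 L) (c : Fin 3), |v e c| ≤ T) ∧ ‖linkEmbed L v‖ ≤ R)
    (hWc : ∀ g : Site 3 L → SU2, W g ≠ 0 → (∀ x, ‖su2Quat (g x) - 1‖ ≤ T) ∧ ‖∑ x, vecPart (g x)‖ ≤ Γ)
    {χ₀ : GaugeConfig 3 1 SU2 → ℝ} (hχm : Measurable χ₀) {Cχ : ℝ} (hCχ : ∀ u, |χ₀ u| ≤ Cχ) (hχ0 : ∀ u, 0 ≤ χ₀ u)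
    (hχw : ∀ u, χ₀ u ≠ 0 → (∀ k : Fin 3, ‖su2Quat (u (0, k)) - 1‖ ≤ δu) ∧ (L : ℝ) ^ 3 * wilsonAction su2Rep u ≤ σ)
    (hI0 : 0 < ∫ u, χ₀ u * (transferKernel su2Rep ((L : ℝ) ^ 3 * β) (1 : GaugeConfig 3 1 SU2) u / transferKernel su2Rep ((L : ℝ) ^ 3 * β) (1 : GaugeConfig 3 1 SU2) 1)
      ∂configMeasure SU2 1)
    {v' : Edge 3 L → Fin 3 → ℝ} (hv' : v' ∈ capBalancedSet L) (hv'T : ∀ (e : Edge 3 L) (c : Fin 3), |v' e c| ≤ T) {Rin : ℝ} (hx' : ‖linkEmbed L v'‖ ≤ Rin) (hRin : Rin ≤ R)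
    -- the chart radius and the inner radius of the lower Gaussian hypothesis
    {ρ R₀ : ℝ} (hρ : 0 < ρ) (hρ2 : ρ ≤ 1 / 2) (hTρ : 8 * T ≤ ρ) (hR₀ : 6 * T ^ 2 * Rin ≤ R₀)
    -- (C1c'): the localised average is two-sided Gaussian on the chart ball
    {gm gp : ℝ} (hgm : 0 ≤ gm)
    (hAlo : ∀ w : Edge 3 L → Fin 3 → ℝ, (∀ e, ∑ a, w e a ^ 2 ≤ ρ ^ 2) → ‖chartVec w - linkEmbed L v'‖ ≤ R₀ →
      gm * Real.exp (-stiffGaussExp L (β / 2) β (chartVec w)) ≤ ∫ g, W g * boFun L χ₀ Ω (gaugeTransform g⁻¹ (latPatternChart L (fun _ => false) w)) ∂gaugeMeasure L)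
    (hAhi : ∀ w : Edge 3 L → Fin 3 → ℝ, (∀ e, ∑ a, w e a ^ 2 ≤ ρ ^ 2) →
      ∫ g, W g * boFun L χ₀ Ω (gaugeTransform g⁻¹ (latPatternChart L (fun _ => false) w)) ∂gaugeMeasure L ≤ gp * Real.exp (-stiffGaussExp L (β / 2) β (chartVec w))) :
    Real.exp (-(coreEta L β 0 δu T R Γ σ + coreEps1 L β 0 T R + coreEps2 L β 0 T R σ)) *
          (1 * (Real.exp (2 * β) ^ Fintype.card (Edge 3 L) * ((2 * π ^ 2)⁻¹ * ((1 + ρ ^ 2)⁻¹) ^ 2) ^ Fintype.card (Edge 3 L) *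
              Real.exp (-(2000 * Fintype.card (Plaquette 3 L) * ρ ^ 3 * β)) * gm *
            (Real.exp (-(882 * β * T ^ 2 * Rin ^ 2)) -
              Real.exp (49 * β * Rin ^ 2) * (Real.exp (-(β * (min (ρ - 2 * T) (R₀ - 6 * T ^ 2 * Rin)) ^ 2 / 2)) * (π / (β / 2)) ^ ((Module.finrank ℝ (LinkSpace L) : ℝ) / 2)) /
                stiffGaussTop L (β / 2) β)) *
            (stiffGaussTop L (β / 2) β * Real.exp (-stiffGaussExp L (β / 2) β (linkEmbed L v')))) /
          (∫ u, χ₀ u * (transferKernel su2Rep ((L : ℝ) ^ 3 * β) (1 : GaugeConfig 3 1 SU2) u / transferKernel su2Rep ((L : ℝ) ^ 3 * β) (1 : GaugeConfig 3 1 SU2) 1)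
            ∂configMeasure SU2 1) ≤ fpFibreTransfer L β Ω W (orthoTube L 1 v') 1 ∧
      fpFibreTransfer L β Ω W (orthoTube L 1 v') 1 ≤
        Real.exp (coreEta L β 0 δu T R Γ σ + coreEps1 L β 0 T R + coreEps2 L β 0 T R σ) *
          (1 * (Real.exp (2 * β) ^ Fintype.card (Edge 3 L) * ((2 * π ^ 2)⁻¹) ^ Fintype.card (Edge 3 L) * Real.exp (2000 * Fintype.card (Plaquette 3 L) * ρ ^ 3 * β) *
                Real.exp (8 * Fintype.card (Edge 3 L) * β * ρ ^ 4) * gp * Real.exp (882 * β * T ^ 2 * Rin ^ 2) +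
              Cχ * CΩ * CW * (Real.exp (2 * β) ^ Fintype.card (Edge 3 L) * Real.exp (-(β * ρ ^ 2 / 4))) * Real.exp (49 * β * Rin ^ 2) / stiffGaussTop L (β / 2) β) *
            (stiffGaussTop L (β / 2) β * Real.exp (-stiffGaussExp L (β / 2) β (linkEmbed L v')))) /
          (∫ u, χ₀ u * (transferKernel su2Rep ((L : ℝ) ^ 3 * β) (1 : GaugeConfig 3 1 SU2) u / transferKernel su2Rep ((L : ℝ) ^ 3 * β) (1 : GaugeConfig 3 1 SU2) 1)
            ∂configMeasure SU2 1) := by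
  haveI : IsProbabilityMeasure (gaugeMeasure L) := by unfold gaugeMeasure; infer_instance
  set A : GaugeConfig 3 L SU2 → ℝ := fun V => ∫ g, W g * boFun L χ₀ Ω (gaugeTransform g⁻¹ V) ∂gaugeMeasure L with hA
  obtain ⟨hAm, hAb⟩ := localisedAvg_boFun_props hΩm hCΩ hW hCW hχm hCχ
  have hCW0 : 0 ≤ CW := (abs_nonneg _).trans (hCW 1)
  have hCχ0 : 0 ≤ Cχ := (abs_nonneg _).trans (hCχ 1)
  have hCΩ0 : 0 ≤ CΩ := (abs_nonneg _).trans (hCΩ 0)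
  -- `A ≥ 0` and `|A| ≤ Cχ·CΩ·CW`
  have hbo0 : ∀ V, 0 ≤ boFun L χ₀ Ω V := fun V => by
    unfold boFun; exact mul_nonneg (Set.indicator_nonneg (fun _ _ => zero_le_one) _) (mul_nonneg (hχ0 _) (hΩ0 _))
  have hA0 : ∀ V, 0 ≤ A V := fun V => integral_nonneg fun g => mul_nonneg (hW0 g) (hbo0 _)
  have hAC : ∀ V, |A V| ≤ Cχ * CΩ * CW := fun V => (hAb V).trans (le_of_eq (by ring))
  -- the two bricks
  have hC1c : ∀ V : GaugeConfig 3 L SU2, 1 * A V ≤ ∫ g, W g * boFun L χ₀ Ω (gaugeTransform g⁻¹ V) ∂gaugeMeasure L ∧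
      ∫ g, W g * boFun L χ₀ Ω (gaugeTransform g⁻¹ V) ∂gaugeMeasure L ≤ 1 * A V := fun V => by rw [one_mul]; exact ⟨le_rfl, le_rfl⟩
  have hlo := central_gaussian_tube_lower_local (L := L) hβ hρ hρ2 hT0 hTρ hR₀ hv'T hx' hAm hAC hA0 hgm hAlo
  have hhi := central_gaussian_tube_upper (L := L) hβ hρ hρ2 hT0 hTρ hv'T hx' hAm hAC hA0 hAhi
  exact central_transfer_two_sided_of_bricks hβ.le hΩm hCΩ hΩ0 hW hCW hW0 hδu1 hT hσ0 hσ hΩt hWc hχm hCχ hχ0 hχw hI0 hv' hv'T (hx'.trans hRin) hAm hAC zero_le_one zero_le_one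
    hC1c ⟨hlo, hhi⟩


end Summit.QuantumFields.YangMills.Theorems.FemtoTransferGap.TwoLattice.ConstTube

end
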